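import Literature.NumberTheory.Automorphic.ArchEndoscopicChartTorusRange        -- ★ p849730 B1: `mem_chartTorusH_iff` (T_S = the chart points); brings ★ p849670 (T-MEAS) `chartOrbH`, `chartHaarH`, …
import Literature.MeasureTheory.Group.QuotientOrbitalNormalizerInvariance      -- ★ p849797 (β): `integral_descConj_conj_eq'`, `map_conj_eq_self_of_conj_conj_eq`
import Literature.NumberTheory.Automorphic.ArchCartanCoordinates               -- ★ (COORD) `ArchCartan.negXAt`
import HarnessLib

/-!
# The realised reflection of the split Cartan: `chartOrbH νH S fH (negXAt w c) = chartOrbH νH S fH c`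
# ((W-real) of the LH3 direct road: Shelstad 1979 §4; Rogawski 1990 §3.6, §8.2; Folland 1995 §2.6; Deitmar–Echterhoff 2014 Thm. 1.5.3)

Topic `NumberTheory/Automorphic`; namespace `Literature.NumberTheory.Automorphic.UnitaryGroup`.  THEOREMS ONLY (no `def`, no instance, no notation, no axiom, no named
fact, no `sorry`).  Cell `pub/hodgecm-mathlib`, crux H413 (`stmt-HodgeConjecture-24833`), F0∕P3c line LH3 (closer stub `stub_N9`, DIRECT ROAD); organ «(W-real)» (γ)
(LH3-plan (g2) 2026-09-02T05:53:17Z), seat LH2-p04 (g3): the ONE hypothesis `hneg` of ★ p849717 `archBzWeyl_stOrbFamH` (LH3-p01).  Count-neutral kit.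

THE MATHEMATICS.  At a split place `w ∈ S` the coordinate reflection `x_w ↦ −x_w` (★ `negXAt w`) of the chart `endoTorus S` is REALISED in `H_∞`: the element
`n_w` whose `U(Φ₂)_w`-block is the swap `J = antidiag(1,1) = Φ₂` (a `Φ₂`-unitary involution: `Jᴴ Φ₂ J = Φ₂`, `J² = 1`) and which is `1` at the other places and on
`U(Φ₁)` conjugates `diag(e^{x+iθ}, e^{−x+iθ})` to `diag(e^{−x+iθ}, e^{x+iθ})`:
* §1 `swapGL_mem_archLocal`, `swapGL_mul_swapGL`, `swapGL_inv`, `swapGL_conj_hypBlockGL` (the local algebra);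
* §2 **`exists_conj_endoTorus_eq_negXAt`** — `∃ n : H_∞, n * n = 1 ∧ ∀ c, n · endoTorus S c · n⁻¹ = endoTorus S (negXAt w c)` (assembled through ★ `archPiEquivCM` with
  `Pi.mulSingle w J`); hence `n` normalises `T_S` (★ `mem_chartTorusH_iff`) and `Ad(n)` is an involution of `T_S`, so `Ad(n)_* dt_S = dt_S` (★ `map_conj_eq_self_of_conj_conj_eq`);
* §3 **`chartOrbH_negXAt (hw : w ∈ S) (fH) (c) : chartOrbH νH S fH (negXAt w c) = chartOrbH νH S fH c`** for EVERY `c` and every Haar `νH` — ★ (β)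
  `integral_descConj_conj_eq'` (the right translation `y ↦ y n⁻¹` preserves the quotient measure), the box-mass prefactor being untouched.  This is Shelstad's
  «`Φ^T_f` is invariant under the realised Weyl group» for the real root of the split Cartan of `U(1,1)`.
HONEST LABEL: HC_CM is proved only modulo the 7 printed citations (2 remaining: hLiu418 = `stmt-HodgeConjecture-24832`, h413 = `stmt-HodgeConjecture-24833`) until rung 0 closes;
count-neutral.

## References
* [Shelstad1979] D. Shelstad, *Characters and inner forms of a quasi-split group over ℝ*, Compositio Math. 39 (1979), §4 pp. 22–23 (invariance of `Φ^T_f` under `Ω(G,T)`; real roots).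
* [Rogawski1990] J. D. Rogawski, *Automorphic Representations of Unitary Groups in Three Variables*, Ann. of Math. Stud. 123 (1990), §3.6 p. 31 (the split Cartan of `U(1,1)`,
  its Weyl group), §8.2 p. 122.
* [Folland1995] G. B. Folland, *A Course in Abstract Harmonic Analysis* (1995), §2.6 Thm. 2.49.
* [DeitmarEchterhoff2014] A. Deitmar, S. Echterhoff, *Principles of Harmonic Analysis*, 2nd ed. (2014), Thm. 1.5.3.
-/

set_option autoImplicit false

noncomputable section

open MeasureTheory MeasureTheory.Measure NumberField NumberField.InfinitePlace Matrix Complex Topology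
open Literature.MeasureTheory.Group Literature.NumberTheory.Automorphic.ArchCartan
open scoped MatrixGroups Matrix ComplexConjugate Classical

namespace Literature.NumberTheory.Automorphic.UnitaryGroup

open Literature.NumberTheory.Rogawski1990

/-! ## §1 The swap `J = antidiag(1,1)` in `U(Φ₂)(ℂ)` -/

section Swap

/-- `det antidiag(1,1) = −1 ≠ 0`. [cite: Rogawski1990, §3.6 p. 31] -/
theorem det_swapTwo_ne_zero : Matrix.det !![(0 : ℂ), 1; 1, 0] ≠ 0 := by
  rw [Matrix.det_fin_two_of]; norm_num

/-- `J² = 1`. [cite: Rogawski1990, §3.6 p. 31] -/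
theorem swapGL_mul_swapGL :
    Matrix.GeneralLinearGroup.mkOfDetNeZero !![(0 : ℂ), 1; 1, 0] det_swapTwo_ne_zero * Matrix.GeneralLinearGroup.mkOfDetNeZero !![(0 : ℂ), 1; 1, 0] det_swapTwo_ne_zero = 1 := by
  refine Matrix.GeneralLinearGroup.ext fun i j => ?_
  rw [Units.val_mul, Matrix.GeneralLinearGroup.val_mkOfDetNeZero, Units.val_one]
  fin_cases i <;> fin_cases j <;> simp [Matrix.mul_apply, Fin.sum_univ_two]

/-- `J⁻¹ = J`. [cite: Rogawski1990, §3.6 p. 31] -/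
theorem swapGL_inv :
    (Matrix.GeneralLinearGroup.mkOfDetNeZero !![(0 : ℂ), 1; 1, 0] det_swapTwo_ne_zero)⁻¹ = Matrix.GeneralLinearGroup.mkOfDetNeZero !![(0 : ℂ), 1; 1, 0] det_swapTwo_ne_zero :=
  inv_eq_of_mul_eq_one_right swapGL_mul_swapGL

variable (L : Type) [Field L] (w : {w : InfinitePlace L // IsComplex w})

/-- **`J = antidiag(1,1) ∈ U(Φ₂)_w`** (`J` is real symmetric and `J Φ₂ J = Φ₂` since `J = Φ₂`, `J² = 1`). [cite: Rogawski1990, §3.6 p. 31] -/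
theorem swapGL_mem_archLocal :
    Matrix.GeneralLinearGroup.mkOfDetNeZero !![(0 : ℂ), 1; 1, 0] det_swapTwo_ne_zero ∈
      archLocal L 2 (Matrix.of fun i j : Fin 2 => if i.val + j.val + 1 = 2 then (1 : L) else 0) w := by
  rw [mem_archLocal_iff, Literature.NumberTheory.Rogawski1990.antidiagOne_map (w.1.embedding) 2, Matrix.GeneralLinearGroup.val_mkOfDetNeZero]
  ext i j
  fin_cases i <;> fin_cases j <;> simp [Matrix.mul_apply, Fin.sum_univ_two]

/-- **`J · diag(e^{x+iθ}, e^{−x+iθ}) · J⁻¹ = diag(e^{−x+iθ}, e^{x+iθ})`**: the swap realises `x ↦ −x` on the split Cartan. [cite: Rogawski1990, §3.6 p. 31] [cite: Shelstad1979, §4 p. 22] -/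
theorem swapGL_conj_hypBlockGL (x θ : ℝ) :
    Matrix.GeneralLinearGroup.mkOfDetNeZero !![(0 : ℂ), 1; 1, 0] det_swapTwo_ne_zero * hypBlockGL x θ *
        (Matrix.GeneralLinearGroup.mkOfDetNeZero !![(0 : ℂ), 1; 1, 0] det_swapTwo_ne_zero)⁻¹ = hypBlockGL (-x) θ := by
  rw [swapGL_inv]
  refine Matrix.GeneralLinearGroup.ext fun i j => ?_
  rw [Units.val_mul, Units.val_mul, Matrix.GeneralLinearGroup.val_mkOfDetNeZero, coe_hypBlockGL, coe_hypBlockGL]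
  fin_cases i <;> fin_cases j <;> simp [Matrix.mul_apply, Fin.sum_univ_two]

end Swap

/-! ## §2 The realised reflection `n_w ∈ H_∞` -/

section Reflection

variable (L : Type) [Field L] [NumberField L] [IsCMField L] (S : Finset {w : InfinitePlace L // IsComplex w})

/-- **THE REFLECTION OF THE SPLIT CARTAN IS REALISED IN `H_∞`**: for `w ∈ S` there is `n ∈ H_∞` (the swap `J` at the place `w`, `1` elsewhere and on `U(Φ₁)`) with
`n² = 1` and `n · endoTorus S c · n⁻¹ = endoTorus S (negXAt w c)` for EVERY coordinate `c`. [cite: Shelstad1979, §4 pp. 22–23] [cite: Rogawski1990, §3.6 p. 31] -/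
theorem exists_conj_endoTorus_eq_negXAt {w : {w : InfinitePlace L // IsComplex w}} (hw : w ∈ S) :
    ∃ n : ↥(arch (↥(maximalRealSubfield L)) L (IsCMField.complexConj L) 2 (Matrix.of fun i j : Fin 2 => if i.val + j.val + 1 = 2 then (1 : L) else 0)) ×
        ↥(arch (↥(maximalRealSubfield L)) L (IsCMField.complexConj L) 1 (Matrix.of fun i j : Fin 1 => if i.val + j.val + 1 = 1 then (1 : L) else 0)),
      n * n = 1 ∧ ∀ c, n * endoTorus L S c * n⁻¹ = endoTorus L S (negXAt w c) := by
  set E₂ := archPiEquivCM 2 L (Matrix.of fun i j : Fin 2 => if i.val + j.val + 1 = 2 then (1 : L) else 0) with hE₂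
  set Jw : ↥(archLocal L 2 (Matrix.of fun i j : Fin 2 => if i.val + j.val + 1 = 2 then (1 : L) else 0) w) :=
    ⟨Matrix.GeneralLinearGroup.mkOfDetNeZero !![(0 : ℂ), 1; 1, 0] det_swapTwo_ne_zero, swapGL_mem_archLocal L w⟩ with hJw
  have hJJ : Jw * Jw = 1 := Subtype.ext swapGL_mul_swapGL
  refine ⟨(E₂.symm (Pi.mulSingle w Jw), 1), ?_, fun c => ?_⟩
  · rw [Prod.mk_mul_mk, mul_one, ← map_mul, ← Pi.mulSingle_mul, hJJ, Pi.mulSingle_one, map_one]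
    rfl
  · refine Prod.ext ?_ ?_
    · -- the `U(Φ₂)` component, place by place
      simp only [Prod.fst_mul, Prod.fst_inv]
      apply E₂.injective
      rw [map_mul, map_mul, map_inv, ContinuousMulEquiv.apply_symm_apply]
      funext v
      rw [Pi.mul_apply, Pi.mul_apply, Pi.inv_apply, archPiEquivCM_endoTorus_fst, archPiEquivCM_endoTorus_fst]
      -- GL-level readings of the blocks (no dependent subtype proofs in the way)
      have hGL : ∀ (c' : {w : InfinitePlace L // IsComplex w} → Fin 3 → ℝ) (v : {w : InfinitePlace L // IsComplex w}), v ∈ S →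
          ((endoBlock L S c' v : ↥(archLocal L 2 _ v)) : GL (Fin 2) ℂ) = hypBlockGL (c' v 0) (c' v 2) := fun c' v hv =>
        Units.ext (by rw [coe_endoBlock_of_mem L c' hv, coe_hypBlockGL])
      by_cases hv : v = w
      · subst hv
        rw [Pi.mulSingle_eq_same]
        apply Subtype.ext
        simp only [Subgroup.coe_mul, Subgroup.coe_inv, hJw]
        rw [hGL c v hw, hGL (negXAt v c) v hw, negXAt_apply_self]
        simp only [Matrix.cons_val_zero, Matrix.cons_val_two, Matrix.tail_cons, Matrix.head_cons]
        exact swapGL_conj_hypBlockGL _ _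
      · rw [Pi.mulSingle_eq_of_ne hv, one_mul, inv_one, mul_one]
        apply Subtype.ext
        apply Units.ext
        by_cases hvS : v ∈ S
        · rw [coe_endoBlock_of_mem L _ hvS, coe_endoBlock_of_mem L _ hvS, negXAt_apply_of_ne hv]
        · rw [coe_endoBlock_of_not_mem L _ hvS, coe_endoBlock_of_not_mem L _ hvS, negXAt_apply_of_ne hv]
    · -- the `U(Φ₁)` component is untouched (`negXAt` fixes the slot `1`)
      simp only [Prod.snd_mul, Prod.snd_inv, one_mul, inv_one, mul_one]
      unfold endoTorus
      simp only
      congr 1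
      funext v
      apply Subtype.ext
      apply Units.ext
      rw [coe_endoCircle, coe_endoCircle]
      by_cases hv : v = w
      · subst hv
        rw [negXAt_apply_self]
        rfl
      · rw [negXAt_apply_of_ne hv]

end Reflection

/-! ## §3 `chartOrbH` is even in `x_w` -/

section Even

variable (L : Type) [Field L] [NumberField L] [IsCMField L]
  [MeasurableSpace (↥(arch (↥(maximalRealSubfield L)) L (IsCMField.complexConj L) 2 (Matrix.of fun i j : Fin 2 => if i.val + j.val + 1 = 2 then (1 : L) else 0)) ×
      ↥(arch (↥(maximalRealSubfield L)) L (IsCMField.complexConj L) 1 (Matrix.of fun i j : Fin 1 => if i.val + j.val + 1 = 1 then (1 : L) else 0)))]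
  [BorelSpace (↥(arch (↥(maximalRealSubfield L)) L (IsCMField.complexConj L) 2 (Matrix.of fun i j : Fin 2 => if i.val + j.val + 1 = 2 then (1 : L) else 0)) ×
      ↥(arch (↥(maximalRealSubfield L)) L (IsCMField.complexConj L) 1 (Matrix.of fun i j : Fin 1 => if i.val + j.val + 1 = 1 then (1 : L) else 0)))]
  (νH : Measure (↥(arch (↥(maximalRealSubfield L)) L (IsCMField.complexConj L) 2 (Matrix.of fun i j : Fin 2 => if i.val + j.val + 1 = 2 then (1 : L) else 0)) ×
      ↥(arch (↥(maximalRealSubfield L)) L (IsCMField.complexConj L) 1 (Matrix.of fun i j : Fin 1 => if i.val + j.val + 1 = 1 then (1 : L) else 0))))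
  [νH.IsHaarMeasure] [νH.IsMulRightInvariant]
  (S : Finset {w : InfinitePlace L // IsComplex w})

/-- **`chartOrbH` IS INVARIANT UNDER THE REALISED REFLECTION `x_w ↦ −x_w` OF A SPLIT PLACE** — for EVERY coordinate `c` and every Haar measure `νH` on `H_∞`:
`chartOrbH νH S fH (negXAt w c) = chartOrbH νH S fH c`.  (The reflection is conjugation by `n_w` (`exists_conj_endoTorus_eq_negXAt`); `n_w` normalises `T_S` and
`Ad(n_w)` is an involution of `T_S`, so ★ `integral_descConj_conj_eq'` applies; the box-mass prefactor is unchanged.)  The hypothesis `hneg` of ★ p849717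
`archBzWeyl_stOrbFamH`, unconditionally. [cite: Shelstad1979, §4 pp. 22–23] [cite: Rogawski1990, §3.6 p. 31; §8.2 p. 122] [cite: DeitmarEchterhoff2014, Thm. 1.5.3] -/
theorem chartOrbH_negXAt {w : {w : InfinitePlace L // IsComplex w}} (hw : w ∈ S)
    (fH : ↥(arch (↥(maximalRealSubfield L)) L (IsCMField.complexConj L) 2 (Matrix.of fun i j : Fin 2 => if i.val + j.val + 1 = 2 then (1 : L) else 0)) ×
      ↥(arch (↥(maximalRealSubfield L)) L (IsCMField.complexConj L) 1 (Matrix.of fun i j : Fin 1 => if i.val + j.val + 1 = 1 then (1 : L) else 0)) → ℂ)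
    (c : {w : InfinitePlace L // IsComplex w} → Fin 3 → ℝ) :
    chartOrbH L νH S fH (negXAt w c) = chartOrbH L νH S fH c := by
  letI : MeasurableSpace ((↥(arch (↥(maximalRealSubfield L)) L (IsCMField.complexConj L) 2 (Matrix.of fun i j : Fin 2 => if i.val + j.val + 1 = 2 then (1 : L) else 0)) ×
      ↥(arch (↥(maximalRealSubfield L)) L (IsCMField.complexConj L) 1 (Matrix.of fun i j : Fin 1 => if i.val + j.val + 1 = 1 then (1 : L) else 0))) ⧸ chartTorusH L S) := borel _
  haveI : BorelSpace ((↥(arch (↥(maximalRealSubfield L)) L (IsCMField.complexConj L) 2 (Matrix.of fun i j : Fin 2 => if i.val + j.val + 1 = 2 then (1 : L) else 0)) ×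
      ↥(arch (↥(maximalRealSubfield L)) L (IsCMField.complexConj L) 1 (Matrix.of fun i j : Fin 1 => if i.val + j.val + 1 = 1 then (1 : L) else 0))) ⧸ chartTorusH L S) := ⟨rfl⟩
  haveI := isHaarMeasure_chartHaarH L S
  haveI := isInvInvariant_chartHaarH L S
  obtain ⟨n, hnn, hconj⟩ := exists_conj_endoTorus_eq_negXAt L S hw
  have hninv : n⁻¹ = n := inv_eq_of_mul_eq_one_right hnn
  -- `n` normalises `T_S`
  have hnT : ∀ g, n * g * n⁻¹ ∈ chartTorusH L S ↔ g ∈ chartTorusH L S := by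
    intro g
    constructor
    · intro hg
      obtain ⟨c', hc'⟩ := (mem_chartTorusH_iff L S _).mp hg
      have hg' : g = n * endoTorus L S c' * n⁻¹ := by
        rw [hc', hninv, ← mul_assoc, ← mul_assoc, hnn, one_mul, mul_assoc, hnn, mul_one]
      rw [hg', hconj c']
      exact endoTorus_mem_chartTorusH L S _
    · intro hg
      obtain ⟨c', hc'⟩ := (mem_chartTorusH_iff L S _).mp hg
      rw [← hc', hconj c']
      exact endoTorus_mem_chartTorusH L S _
  -- `Ad(n)` is an involution of `T_S`
  have h2 : ∀ x : ↥(chartTorusH L S), n * (n * (x : _) * n⁻¹) * n⁻¹ = x := fun x => by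
    rw [hninv, ← mul_assoc, ← mul_assoc, hnn, one_mul, mul_assoc, hnn, mul_one]
  have ht := map_conj_eq_self_of_conj_conj_eq (chartTorusH L S) (chartHaarH L S) hnT (isClosed_chartTorusH L S) h2
  -- the two integrands: the point `endoTorus S (negXAt w c) = n · endoTorus S c · n⁻¹`
  have hint : descConj (endoTorus L S (negXAt w c)) (chartTorusH L S) (forall_mem_chartTorusH_comm L S (negXAt w c)) fH =
      descConj (n * endoTorus L S c * n⁻¹) (chartTorusH L S)
        (fun g hg => by rw [hconj c]; exact forall_mem_chartTorusH_comm L S (negXAt w c) g hg) fH := by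
    funext y
    induction y using QuotientGroup.induction_on with
    | H g => rw [descConj_mk, descConj_mk, hconj c]
  rw [chartOrbH_def, chartOrbH_def, hint]
  congr 1
  exact integral_descConj_conj_eq' (chartTorusH L S) (isClosed_chartTorusH L S) (chartHaarH L S) νH hnT ht
    (forall_mem_chartTorusH_comm L S c) _ fH

end Even

end Literature.NumberTheory.Automorphic.UnitaryGroup

end
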